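import Summits.BirchSwinnertonDyer.Rank1Residual.P2.CongruentNumberPairsAtTwoDoorAAtlasThree
import HarnessLib

/-!
# Sub-lane «bsd-p2»: A DOOR FOR THE TYZ-SILENT ODD THREE-PRIME FAMILY
# `U₃⁰ = {p·q·r : p ≡ 5, q ≡ r ≡ 7 (mod 8) primes, q ≠ r, (q/p) = (r/p) = −1}` IN THE SHAPE OF D-CN-5:
# `ord_{s=1} L = 1`, rank `1`, `Ш[2^∞] = 0` and `BSD(E_n, 2) ⟺ ord₂(L′(E_n,1)/(Ω·Reg)) = 3` from ANY
# rank-one datum, modulo Monsky's matrix theorem `hM` and GZK ONLY (bookkeeping; 0 facts; 0 (K);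
# landed p346251 on p2-lead WAKE-T-139; twin of the even `ℓ = 3` door
# `P2/CongruentNumberPairsAtTwoEvenThreePrimesDoor.lean`)

HONEST FRAMING (sub-lane «bsd-p2», run/shared/lean/b2b/bsd-rank1-residual/p2/, verbatim in every
file): the target of record is the FULL Birch–Swinnerton-Dyer formula for EVERY analytic-rank `≤ 1`
`E/ℚ` at ALL primes INCLUDING `2`; the odd-prime class ledger is referee A's; the `2`-part is OPEN
(cells O1 = X5 ∖ CM and O12 = the CM corner) and under census by «bsd-p2». Census / instrument
output at `2` = EVIDENCE / conjecture items with held-out validation, NEVER a Literature fact;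
certificates close PAIRS (one isogeny class, `p = 2`), never classes. This file asserts NO
arithmetic fact: per-pair biconditionals whose only arithmetic inputs are the NAMED PUBLISHED FACTS
`hM` (Monsky's `2`-descent matrix theorem, appendix to Heath-Brown 1994:
`HeathBrown1994.monsky_card_selmerGroup_two_odd`) and `hGZK` (Gross–Zagier–Kolyvagin:
`rank_eq_analyticRank_of_analyticRank_le_one`), both already binders of the landed `ω = 3` door.

THE FAMILY (tree facts, nothing new). For distinct primes `p ≡ 5`, `q ≡ r ≡ 7 (mod 8)` with
`(q/p) = (r/p) = −1`, `n = pqr ≡ 5 (mod 8)`: root number `−1`; the Legendre configuration is the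
EXCEPTIONAL class-`5` configuration of the landed `ω = 3` atlas (`exceptionalFiveCfg`,
`P2/CongruentNumberPairsAtTwoDoorAAtlasThree{Census,}.lean`): Monsky kernel `2` — `s(n) = 1`
(`cfg_of_exceptionalFive`), so `#Sel₂(E_n) = 8` by `hM` and, granted rank `1`, `Ш(E_n)[2^∞] = 0`
(`primaryComponent_sha_two_eq_bot_of_card_selmerGroup_eq_eight`) — yet `Σ₁(n)`, `Σ₂′(n)` are EVEN:
Tian–Yuan–Zhang Thm 1.2 / U⁺ are SILENT (`selmerRankOne_genusSums_even_of_exceptionalFive`), Tian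
2014 Thm 1.3 needs primes `≡ 1 (mod 8)`, and `n ∉` Monsky 1990 Cor 5.15's families (`IsCor515Family`
has at most two odd primes) — the landed door D-CN-5 `bsdp_two_congruentNumberCurve_iff_of_cor515`
does NOT apply. `#E_n(ℚ)_tors = 4` (`torsionOrder_congruentNumberCurve`), `∏_ℓ c_ℓ(E_n) = 2⁷`
(`tamagawaProduct_congruentNumberCurve_prod`), so `#Ш_an = x·16/2⁷ = x/8` for a datum
`L′(E_n,1) = x·Ω·Reg`.

THE DOOR (this file). With `s(n) = 1` a THEOREM (census + transfer, §1) the generic rank-one spec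
`bsdp_two_iff_of_LDerivOverOmegaReg_of_sha_two_eq_bot_of_torsionOrder_eq_four` (GZK) becomes, on
`U₃⁰`: ANY datum `x ≠ 0` gives `ord_{s=1} L(E_n, s) = 1` (root number, no fact), rank `1` (GZK),
`Ш[2^∞] = 0` (`hM` + Silverman X.4.2) and `BSD(E_n, 2) ⟺ ord₂ x = 3` (§2, tuple form and `(p, q, r)`
form). CONSUMERS: a kernel pair certificate on `U₃⁰` (an exact `L′/(Ω·Reg)`, e.g. from a Heegner point
as in `P2/HeegnerIndexAtTwo.lean`) closes `BSD(E_n, 2)` for that PAIR through this door; the pre-draft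
law C-P2-2 (`p2/STRUCTURE-p2.md` v0.6 §7; p2-lead SWEEP 2026-08-24) is typed AGAINST this door in
`P2/Conjectures/CongruentNumberSilentOddFiveSevenSevenAtTwo.lean` (draft). The cell is `openO12`
(CM, `2` ramified, additive); per-pair statements close no class. Nothing booked; no mark moved.
Unit `b2b-bsdres-p2-typer` GEN 12 (drafted on p2-lead WAKE-T-137 @bd432c8141a095ba; landed p346251
on WAKE-T-139 @51fcc73a3ef8101c; header wording per p2-ref R-G19-51's rider, GEN 13).

References: [HeathBrown1994SelmerCongruentII] Appendix (Monsky), typescript p. 39 L10–L33;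
[Monsky1990MockHeegner] Cor 5.15 (p. 66), Remark (3) (p. 67); [TianYuanZhang2017] Thm 1.2, §1 (1.1);
[SilvermanAEC2009] Thm X.4.2; [Miller2011LMS] Def 1.1; [IrelandRosen1990] Ch. 5 §1–§2;
HOME `p2/STRUCTURE-p2.md` v0.6 §4 N-P2-5, §7; `p2/LEAD-OKS.md` T-122 (5), T-137.
-/

noncomputable section

open scoped Classical

open Matrix WeierstrassCurve Literature.NumberTheory.EllipticCurves
  Literature.NumberTheory.EllipticCurves.Rank1Residual
  Literature.NumberTheory.EllipticCurves.Rank1Residual.Typed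
  Literature.NumberTheory.EllipticCurves.HeathBrown1994
  Literature.NumberTheory.EllipticCurves.TianYuanZhang2017
  Literature.NumberTheory.QuadraticFields
  Literature.NumberTheory.QuadraticFields.RedeiReichardt

set_option autoImplicit false

namespace Summit.BirchSwinnertonDyer.Rank1Residual.P2

/-! ## §1 The exceptional class-`5` configuration: residues, product, Monsky kernel (no named fact) -/

section Door

variable (t : Fin 3 → ℕ)

/-- On an exceptional class-`5` configuration every residue is `5` or `7 (mod 8)`; in particular no
prime is `2` and all are odd. [cite: TianYuanZhang2017, Thm. 1.2] -/
theorem mod_eight_of_exceptionalFiveCfg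
    (hexc : exceptionalFiveCfg (fun i => t i % 8) (fun a b => kroneckerBit (t b) (t a)) = true) :
    ∀ j, t j % 8 = 5 ∨ t j % 8 = 7 := by
  obtain ⟨i, hi5, hij⟩ := of_decide_eq_true hexc
  intro j
  by_cases hji : j = i
  · subst hji; left; simpa [Nat.mod_mod] using hi5
  · right; simpa [Nat.mod_mod] using (hij j hji).1

/-- The product of an exceptional class-`5` configuration is `≡ 5 (mod 8)` (`5·7·7`). `decide` on the
residues. [cite: TianYuanZhang2017, Thm. 1.2] -/
theorem prod_mod_eight_of_exceptionalFiveCfg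
    (hexc : exceptionalFiveCfg (fun i => t i % 8) (fun a b => kroneckerBit (t b) (t a)) = true) :
    (∏ i, t i) % 8 = 5 := by
  obtain ⟨i, hi5, hij⟩ := of_decide_eq_true hexc
  have h7 : ∀ j, j ≠ i → t j % 8 = 7 := fun j hj => by simpa [Nat.mod_mod] using (hij j hj).1
  rw [Fin.prod_univ_three, ← mod_eight_mul_three]
  fin_cases i
  · have h0 : t 0 % 8 = 5 := by simpa [Nat.mod_mod] using hi5
    rw [h0, h7 1 (by decide), h7 2 (by decide)]
  · have h1 : t 1 % 8 = 5 := by simpa [Nat.mod_mod] using hi5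
    rw [h1, h7 0 (by decide), h7 2 (by decide)]
  · have h2 : t 2 % 8 = 5 := by simpa [Nat.mod_mod] using hi5
    rw [h2, h7 0 (by decide), h7 1 (by decide)]

/-- **`s(n) = 1` on `U₃⁰` is a THEOREM** (no named fact): on an exceptional class-`5` configuration
Monsky's matrix `monskyMatrixOdd t` has a `2`-element kernel — the landed census
`P2.cfg_of_exceptionalFive` transported through `P2.card_ker_monskyMatrixOdd_eq_cfg`.
[cite: HeathBrown1994SelmerCongruentII, Appendix (Monsky), typescript p. 39 L27–L33] -/
theorem card_ker_monskyMatrixOdd_of_exceptionalFiveCfg (ht : ∀ i, (t i).Prime)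
    (hinj : Function.Injective t)
    (hexc : exceptionalFiveCfg (fun i => t i % 8) (fun a b => kroneckerBit (t b) (t a)) = true) :
    Fintype.card {v : Fin 3 ⊕ Fin 3 → ZMod 2 // monskyMatrixOdd t *ᵥ v = 0} = 2 := by
  have hres := mod_eight_of_exceptionalFiveCfg t hexc
  have ht2 : ∀ j, t j ≠ 2 := fun j h => by have := hres j; rw [h] at this; omega
  obtain ⟨r₀, r₁, r₂, -, hRfun, hBfun⟩ := cfg_three_eq_betaOf t ht ht2 hinj
  rw [hRfun, hBfun] at hexc
  obtain ⟨hker, -, -⟩ := cfg_of_exceptionalFive r₀ r₁ r₂ _ _ _ hexc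
  rw [card_ker_monskyMatrixOdd_eq_cfg t ht ht2 hinj, hRfun, hBfun]
  exact hker

/-! ## §2 The door: `BSD(E_n, 2) ⟺ ord₂ x = 3` from any rank-one datum, modulo `hM`, `hGZK` -/

/-- **THE DOOR FOR `U₃⁰` (shape D-CN-5, binders `hM`, `hGZK` ONLY).** For distinct primes `t₀, t₁, t₂`
in the exceptional class-`5` configuration (`p₅·q₇·r₇`, `(q/p) = (r/p) = −1`), `n = t₀t₁t₂`, and ANY
rank-one datum `L′(E_n, 1) = x·Ω·Reg` with `x ∈ ℚ`, `x ≠ 0`: `ord_{s=1} L(E_n, s) = 1` (root number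
`−1` + `x ≠ 0`, no fact), rank `1` (GZK), `Ш(E_n)[2^∞] = 0` (`s(n) = 1` by the census + Monsky's
`#Sel₂ = 2^{2+s}` + Silverman X.4.2), and `BSD(E_n, 2) ⟺ ord₂ x = ord₂ ∏c_ℓ − 4 = 7 − 4 = 3`. No
Tian–Yuan–Zhang / Rédei–Reichardt / Cor 5.15 binder. Per-pair; closes no class (cell `openO12`).
[cite: HeathBrown1994SelmerCongruentII, Appendix (Monsky), typescript p. 39 L10–L33]
[cite: SilvermanAEC2009, Thm. X.4.2] [cite: Miller2011LMS, Def. 1.1 (arXiv:1010.2431 p. 3)] -/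
theorem rankOne_sha_bsdp_two_iff_congruentNumberCurve_of_exceptionalFiveCfg
    (hGZK : rank_eq_analyticRank_of_analyticRank_le_one) (hM : monsky_card_selmerGroup_two_odd)
    (ht : ∀ i, (t i).Prime) (hinj : Function.Injective t) {n : ℕ} (hn : ∏ i, t i = n)
    (hexc : exceptionalFiveCfg (fun i => t i % 8) (fun a b => kroneckerBit (t b) (t a)) = true)
    {x : ℚ} (hx0 : x ≠ 0)
    (hx : deriv (congruentNumberCurve n).entireLFunction 1 =
      (x : ℂ) * ((congruentNumberCurve n).realPeriodRat : ℂ) *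
        ((congruentNumberCurve n).regulator : ℂ)) :
    (congruentNumberCurve n).analyticRank = 1 ∧ (congruentNumberCurve n).mordellWeilRank = 1 ∧
      AddCommGroup.primaryComponent (congruentNumberCurve n).sha 2 = ⊥ ∧
      (BSDp (congruentNumberCurve n) 2 ↔ padicValRat 2 x = 3) := by
  have hres := mod_eight_of_exceptionalFiveCfg t hexc
  have ht2 : ∀ j, t j ≠ 2 := fun j h => by have := hres j; rw [h] at this; omega
  have hodd : ∀ j, Odd (t j) := fun j => (ht j).odd_of_ne_two (ht2 j)
  have hsq : Squarefree n := hn ▸ squarefree_prod_of_injective t ht hinj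
  have hn0 : n ≠ 0 := hsq.ne_zero
  haveI := isElliptic_congruentNumberCurve hn0
  haveI : Fact (Nat.Prime 2) := ⟨Nat.prime_two⟩
  have h5 : n % 8 = 5 := hn ▸ prod_mod_eight_of_exceptionalFiveCfg t hexc
  -- root number `−1` and `x ≠ 0`: `ord_{s=1} L = 1` (no named fact)
  have hΩ : ((congruentNumberCurve n).realPeriodRat : ℂ) ≠ 0 := by
    exact_mod_cast (congruentNumberCurve n).realPeriodRat_pos_holds.ne'
  have hR : ((congruentNumberCurve n).regulator : ℂ) ≠ 0 := by
    exact_mod_cast (congruentNumberCurve n).regulator_pos'.ne'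
  have hder : deriv (congruentNumberCurve n).entireLFunction 1 ≠ 0 := by
    rw [hx]
    exact mul_ne_zero (mul_ne_zero (by exact_mod_cast hx0) hΩ) hR
  have hr1 : (congruentNumberCurve n).analyticRank = 1 :=
    analyticRank_congruentNumberCurve_eq_one_of_deriv_ne_zero hsq (Or.inl h5) hder
  -- GZK: rank `1`; Monsky + the census kernel: `#Sel₂ = 8`; hence `Ш[2^∞] = 0`
  obtain ⟨hrank, -⟩ := hGZK (congruentNumberCurve n) (le_of_eq hr1)
  rw [hr1] at hrank
  have hs : monskySelmerRankOdd t = 1 :=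
    (monskySelmerRankOdd_eq_one_iff_card_ker t).mpr
      (card_ker_monskyMatrixOdd_of_exceptionalFiveCfg t ht hinj hexc)
  have hsel : Nat.card ((congruentNumberCurve n).selmerGroup 2) = 8 := by
    subst hn
    rw [hM 3 t ht hodd hinj, hs]
    norm_num
  have hbot := primaryComponent_sha_two_eq_bot_of_card_selmerGroup_eq_eight hn0 hrank hsel
  refine ⟨hr1, hrank, hbot, ?_⟩
  rw [bsdp_two_iff_of_LDerivOverOmegaReg_of_sha_two_eq_bot_of_torsionOrder_eq_four
    (congruentNumberCurve n) hGZK hr1 hx hbot (torsionOrder_congruentNumberCurve hsq),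
    tamagawaProduct_congruentNumberCurve_prod t ht hodd hinj hn, padicValNat.prime_pow]
  push_cast
  omega

/-- The `(p, q, r)` form of `U₃⁰` is an exceptional class-`5` configuration: the tuple `![p, q, r]`
consists of distinct primes and `exceptionalFiveCfg` holds at index `0` (Euler's criterion
`kroneckerBit_eq_one_iff_jacobiSym` turns `(q/p) = (r/p) = −1` into the two symbol bits).
[cite: IrelandRosen1990, Ch. 5 §1 Prop. 5.1.2] [cite: TianYuanZhang2017, Thm. 1.2] -/
theorem exceptionalFiveCfg_of_five_seven_seven {p q r : ℕ} (hp : p.Prime) (hq : q.Prime)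
    (hr : r.Prime) (hp5 : p % 8 = 5) (hq7 : q % 8 = 7) (hr7 : r % 8 = 7) (hqr : q ≠ r)
    (hqp : jacobiSym q p = -1) (hrp : jacobiSym r p = -1) :
    (∀ i, (![p, q, r] i).Prime) ∧ Function.Injective ![p, q, r] ∧
      exceptionalFiveCfg (fun i => ![p, q, r] i % 8)
        (fun a b => kroneckerBit (![p, q, r] b) (![p, q, r] a)) = true := by
  have hpq : p ≠ q := fun h => by omega
  have hpr : p ≠ r := fun h => by omega
  have hp2 : p ≠ 2 := by omega
  have hkq : kroneckerBit q p = 1 :=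
    (kroneckerBit_eq_one_iff_jacobiSym hp hp2 (intCast_natCast_prime_ne_zero hq hp hpq.symm)).mpr hqp
  have hkr : kroneckerBit r p = 1 :=
    (kroneckerBit_eq_one_iff_jacobiSym hp hp2 (intCast_natCast_prime_ne_zero hr hp hpr.symm)).mpr hrp
  refine ⟨fun i => by fin_cases i <;> assumption, ?_, ?_⟩
  · intro i j h
    fin_cases i <;> fin_cases j <;> simp_all
  · rw [exceptionalFiveCfg, decide_eq_true_eq]
    refine ⟨0, by simp [hp5], fun j hj => ?_⟩
    fin_cases j
    · exact absurd rfl hj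
    · exact ⟨by simp [hq7], by simpa using hkq⟩
    · exact ⟨by simp [hr7], by simpa using hkr⟩

/-- **THE DOOR FOR `U₃⁰`, `(p, q, r)` form.** For primes `p ≡ 5`, `q ≡ r ≡ 7 (mod 8)`, `q ≠ r`,
`(q/p) = (r/p) = −1` and ANY rank-one datum `L′(E_{pqr}, 1) = x·Ω·Reg`, `x ≠ 0`: `ord_{s=1} L = 1`,
rank `1`, `Ш[2^∞] = 0`, and `BSD(E_{pqr}, 2) ⟺ ord₂ x = 3` — modulo `hM`, `hGZK` only.
[cite: HeathBrown1994SelmerCongruentII, Appendix (Monsky), typescript p. 39 L10–L33]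
[cite: Miller2011LMS, Def. 1.1 (arXiv:1010.2431 p. 3)] -/
theorem rankOne_sha_bsdp_two_iff_congruentNumberCurve_five_seven_seven
    (hGZK : rank_eq_analyticRank_of_analyticRank_le_one) (hM : monsky_card_selmerGroup_two_odd)
    {p q r : ℕ} (hp : p.Prime) (hq : q.Prime) (hr : r.Prime) (hp5 : p % 8 = 5) (hq7 : q % 8 = 7)
    (hr7 : r % 8 = 7) (hqr : q ≠ r) (hqp : jacobiSym q p = -1) (hrp : jacobiSym r p = -1)
    {x : ℚ} (hx0 : x ≠ 0)
    (hx : deriv (congruentNumberCurve (p * q * r)).entireLFunction 1 =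
      (x : ℂ) * ((congruentNumberCurve (p * q * r)).realPeriodRat : ℂ) *
        ((congruentNumberCurve (p * q * r)).regulator : ℂ)) :
    (congruentNumberCurve (p * q * r)).analyticRank = 1 ∧
      (congruentNumberCurve (p * q * r)).mordellWeilRank = 1 ∧
      AddCommGroup.primaryComponent (congruentNumberCurve (p * q * r)).sha 2 = ⊥ ∧
      (BSDp (congruentNumberCurve (p * q * r)) 2 ↔ padicValRat 2 x = 3) := by
  obtain ⟨ht, hinj, hexc⟩ := exceptionalFiveCfg_of_five_seven_seven hp hq hr hp5 hq7 hr7 hqr hqp hrp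
  have hn : ∏ i, ![p, q, r] i = p * q * r := by rw [Fin.prod_univ_three]; rfl
  exact rankOne_sha_bsdp_two_iff_congruentNumberCurve_of_exceptionalFiveCfg _ hGZK hM ht hinj hn hexc
    hx0 hx

end Door

end Summit.BirchSwinnertonDyer.Rank1Residual.P2

end
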